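import Summits.ValiantsHypothesis.ValiantsHypothesis.Theorems.BarrierLeverChowBenchmarkPairsBlockPeelCert363
import Summits.ValiantsHypothesis.ValiantsHypothesis.Theorems.BarrierLeverChowBenchmarkPairsDualisation

/-!
# Route BarrierLever — item 22038 `ChowBenchmarkPairs`, line `moore-peel`: THE ITEM'S OWN STATEMENT AT EVERY HEIGHT `h ≤ 363`
# (computational lane, `Lean.ofReduceBool`) — the Chow benchmark partition minors are hit for all `h ≤ 363`

Helper file, **computational (`Lean.ofReduceBool`, inherited from `…BlockPeelCert363`)** (`--computational --supports
stmt-ValiantsHypothesis-22038`; cell valiant-natproofs, rung V4, line `moore_peel`; seat val-np-p4 gen 29; planner RULING R43).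
Closes NO item; definition-free.  The item `Summit.…Theses.BarrierLever.ChowBenchmarkPairs` is `∀ h, (…)`; this file proves its body
VERBATIM for every `h ≤ 363`: `segmentMeanValueAt_of_le_363_cert` (THEOREM W + block peel theorem + the certified tied block
`{182,183}`) followed by the PROVED transfer `ChowBenchmarkDual.stub_dualisation` (zeon dualisation, p574420; node #2 of the line).

* **`chowBenchmarkPairs_body_of_le_363_cert`** — for every `h ≤ 363`, every `r` and every injective enumeration `u` of the sets of size
  `≤ 2`, some table `B` makes the partition minor of `∏_a (x_a + 1 + Σ_c B a c · y_c)` on rows `u` × the first `r` binary codes nonzero.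

RANGES (R43 (b), never merged): the same body is a KERNEL theorem for `h ≤ 182` (`MoorePeel.stub_window`, p590059, via Theorem A);
COMPUTATIONAL for `h ≤ 363` (here); numerically certified for `h ≤ 20 069` (hypotheses of `segmentMeanValueAt_of_blocks`).

WHAT THIS IS NOT: the item (∀ h) is NOT closed; nothing on crux stmt-ValiantsHypothesis-14610 or on `VP` versus `VNP`.
-/

set_option linter.dupNamespace false

namespace Summit.ValiantsHypothesis.ValiantsHypothesis.Theorems.BarrierLever.MoorePeel

/-- **The body of item 22038 `ChowBenchmarkPairs` for every `h ≤ 363`** (computational lane, `Lean.ofReduceBool`): segment mean-value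
unisolvence up to `363` (`segmentMeanValueAt_of_le_363_cert`) transferred by the zeon dualisation `ChowBenchmarkDual.stub_dualisation`. -/
theorem chowBenchmarkPairs_body_of_le_363_cert (h : ℕ) (hh : h ≤ 363) :
    ∀ (r : ℕ) (u : Fin r → Finset (Fin h)), Function.Injective u → (∀ i, (u i).card ≤ 2) →
      (∀ S : Finset (Fin h), S.card ≤ 2 → ∃ i, u i = S) →
      ∃ B : Fin h → Fin h → ℂ,
        (Matrix.of fun i j : Fin r => MvPolynomial.coeff
          (∑ a ∈ u i, Finsupp.single (Fin.castAdd h a) 1 +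
            ∑ c ∈ Finset.univ.filter (fun c : Fin h => Nat.testBit (j : ℕ) (c : ℕ)), Finsupp.single (Fin.natAdd h c) 1)
          (∏ a : Fin h, (MvPolynomial.X (Fin.castAdd h a) + 1 +
            ∑ c : Fin h, MvPolynomial.C (B a c) * MvPolynomial.X (Fin.natAdd h c)))).det ≠ 0 :=
  ChowBenchmarkDual.stub_dualisation h (segmentMeanValueAt_of_le_363_cert h hh)

end Summit.ValiantsHypothesis.ValiantsHypothesis.Theorems.BarrierLever.MoorePeel
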